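import Literature.Analysis.FluidPDE.PineauVicolOneSliceGradient
import Literature.Analysis.FluidPDE.NSBoundedHigherRegularityQuantProofs
import Literature.Analysis.FluidPDE.LocalPlainPressureBound
import HarnessLib

/-!
# Door S31 `QuietScarPocketDoor`, K-piece PK1 `scarPocketZoom_holds` — brick R for STUB F4a
# `exists_topCurl_of_classZoom`: uniform off-apex regularity of classical zooms up to the top time

Width-seat file (prover ns-imp-p1 g4 under LEAD ns-s30-p1; PK1 skeleton `PK1-Skeleton.lean` sha16
e9d92a063109a968, stub F4a).  Two packaging theorems around the tree's quantitative higher interior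
regularity of bounded distributional Navier–Stokes solutions with an `L^{3/2}` pressure
(`NSBoundedHigherRegularityBounds_holds`, Seregin–Šverák 2009 §2):

* `dist_le_of_holderOnWith`, `norm_fderiv_sub_le_norm_iteratedFDeriv_one_sub` — bookkeeping;
* `exists_cylinder_regularity` — for every radius `c > 0`, velocity bound `A` and pressure mass `P` there
  are ONE sup bound `K`, ONE Hölder constant `C` and exponents `α₀, α₁ > 0` such that every CLASSICAL
  solution `(u, p)` (`ν = 1`, no force) on an open backward cylinder `Q(z, c)` with `‖u‖ ≤ A` there and
  `∫∫_{Q(z,c)} |p − h(t)|^{3/2} ≤ P` for some locally integrable gauge `h` of time satisfies, on the inner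
  cylinder `Q(z, c/2)` (which reaches the top time `z.1`): `‖D_xⁿ u‖ ≤ K` (`n ≤ 2`), and `u`, `D_x u` are
  jointly `(C, α₀)`- resp. `(C, α₁)`-Hölder in `(t, x)` (sup product metric).  The continuous `u` IS the
  smooth representative of the regularity theorem on the open cylinder (`Measure.eqOn_open_of_ae_eq`).
* `exists_zoom_regularity` — the application to the zoom sequence of F3: classical solutions `w k` on
  `Q(R_k, 0)`, `R_k → ∞`, with the one-point bound `‖w k (s,y)‖ ≤ C_u/(√(−s) + ‖y‖)` and Albritton–Barker
  quantity `𝐈 ≤ I`; at every `y₀ ≠ 0`, with `c = ‖y₀‖/4`, EVENTUALLY in `k` the hypotheses above hold on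
  `Q((0,y₀), c)` with `A = C_u/(3c)`, the pressure gauged by its ball mean (`cknD_sub_ballMean_le_of_typeIBound_le`:
  plain mass `≤ c²·I`), so ONE `(K, C, α₀, α₁)` serves all large `k` on `Q((0,y₀), c/2)`.

HONEST FRAMING: a by-name helper for item 0056 (`--supports … --as helper`); door S31, PK1, item 0056
`NoTypeII` and the summit are OPEN; the zooms are HYPOTHETICAL blow-up rescalings; nothing here is a
statement about Navier–Stokes regularity.
-/

noncomputable section

set_option linter.dupNamespace false

namespace Summit.NavierStokesRegularity.NavierStokesRegularity.Theorems.QuietScarPocketDoor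

open MeasureTheory Set Function Filter Topology TopologicalSpace Metric
open scoped NNReal ENNReal Topology
open Literature.Analysis Literature.Analysis.FluidPDE

/-! ## Bookkeeping -/

/-- A Hölder bound on a set, in `dist` form. -/
theorem dist_le_of_holderOnWith {X Y : Type*} [PseudoMetricSpace X] [PseudoMetricSpace Y] {C r : ℝ≥0}
    {f : X → Y} {s : Set X} (hf : HolderOnWith C r f s) {x y : X} (hx : x ∈ s) (hy : y ∈ s) :
    dist (f x) (f y) ≤ C * dist x y ^ (r : ℝ) := by
  have h := hf x hx y hy
  rw [edist_dist, edist_dist, ← ENNReal.ofReal_coe_nnreal,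
    ENNReal.ofReal_rpow_of_nonneg dist_nonneg r.coe_nonneg, ← ENNReal.ofReal_mul C.coe_nonneg] at h
  exact (ENNReal.ofReal_le_ofReal_iff (by positivity)).1 h

/-- The operator norm of a difference of derivatives is at most the norm of the difference of the
corresponding first iterated derivatives. -/
theorem norm_fderiv_sub_le_norm_iteratedFDeriv_one_sub {E F : Type*} [NormedAddCommGroup E]
    [NormedSpace ℝ E] [NormedAddCommGroup F] [NormedSpace ℝ F] (f g : E → F) (x y : E) :
    ‖fderiv ℝ f x - fderiv ℝ g y‖ ≤ ‖iteratedFDeriv ℝ 1 f x - iteratedFDeriv ℝ 1 g y‖ := by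
  refine ContinuousLinearMap.opNorm_le_bound _ (norm_nonneg _) fun v => ?_
  have e : (fderiv ℝ f x - fderiv ℝ g y) v =
      (iteratedFDeriv ℝ 1 f x - iteratedFDeriv ℝ 1 g y) (fun _ => v) := by
    simp only [_root_.sub_apply, iteratedFDeriv_one_apply]
  rw [e]
  refine (ContinuousMultilinearMap.le_opNorm _ _).trans ?_
  simp

/-- Distances of values are distances of zeroth iterated derivatives. -/
theorem dist_iteratedFDeriv_zero₂ {E F : Type*} [NormedAddCommGroup E]
    [NormedSpace ℝ E] [NormedAddCommGroup F] [NormedSpace ℝ F] (f g : E → F) (x y : E) :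
    dist (iteratedFDeriv ℝ 0 f x) (iteratedFDeriv ℝ 0 g y) = dist (f x) (g y) := by
  rw [dist_eq_norm, dist_eq_norm]
  have e : iteratedFDeriv ℝ 0 f x - iteratedFDeriv ℝ 0 g y = iteratedFDeriv ℝ 0 (fun _ => f x - g y) x := by
    ext m
    simp [iteratedFDeriv_zero_apply]
  rw [e, norm_iteratedFDeriv_zero]

/-! ## Uniform regularity on a cylinder, for classical solutions -/

/-- Membership in the inner cylinder implies membership in the outer one. -/
theorem parabolicCylinder_half_subset (c : ℝ) (hc : 0 < c) (z : ℝ × (EuclideanSpace ℝ (Fin 3))) :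
    parabolicCylinder (c / 2) z ⊆ parabolicCylinder c z := by
  intro w hw
  rw [mem_parabolicCylinder] at hw ⊢
  obtain ⟨⟨h1, h2⟩, h3⟩ := hw
  exact ⟨⟨by nlinarith, h2⟩, by linarith⟩

set_option maxHeartbeats 400000 in
/-- **Uniform regularity package on a backward cylinder, for classical solutions.**  For a radius
`c > 0`, a velocity bound `A` and a pressure mass `P` there are constants `K`, `C ≥ 0` and exponents
`α₀, α₁ > 0` with: every classical solution `(u, p)` of the unit-viscosity unforced Navier–Stokes system
on the open cylinder `Q(z, c)` with `‖u‖ ≤ A` on `Q(z, c)` and `∫∫_{Q(z,c)} |p − h(t)|^{3/2} ≤ P` for a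
locally integrable gauge `h` of time has, on `Q(z, c/2)`, spatial derivatives of orders `≤ 2` bounded by
`K`, and `u`, `D_x u` jointly Hölder there with constants `(C, α₀)`, `(C, α₁)`.  (The tree's
`NSBoundedHigherRegularityBounds_holds` for the distributional solution `(u, p − h)` —
`IsDistributionalNSSolutionOn.sub_timeFun` — whose smooth representative coincides with the continuous
`u` on the open cylinder.) -/
theorem exists_cylinder_regularity (c A : ℝ) (P : ℝ≥0) (hc : 0 < c) :
    ∃ K C α₀ α₁ : ℝ, 0 < α₀ ∧ 0 < α₁ ∧ 0 ≤ C ∧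
      ∀ (u : ℝ → (EuclideanSpace ℝ (Fin 3)) → (EuclideanSpace ℝ (Fin 3))) (p : ℝ → (EuclideanSpace ℝ (Fin 3)) → ℝ) (h : ℝ → ℝ) (z : ℝ × (EuclideanSpace ℝ (Fin 3))),
        IsClassicalNSSolutionOnRegion (parabolicCylinder c z) 1 0 u p →
        (∀ w ∈ parabolicCylinder c z, ‖u w.1 w.2‖ ≤ A) →
        LocallyIntegrableOn (fun w : ℝ × (EuclideanSpace ℝ (Fin 3)) => h w.1) (parabolicCylinder c z) volume →
        (∫⁻ w in parabolicCylinder c z, ‖p w.1 w.2 - h w.1‖ₑ ^ (3 / 2 : ℝ) ≤ P) →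
        (∀ w ∈ parabolicCylinder (c / 2) z, ∀ n ≤ 2, ‖iteratedFDeriv ℝ n (u w.1) w.2‖ ≤ K) ∧
        (∀ w ∈ parabolicCylinder (c / 2) z, ∀ w' ∈ parabolicCylinder (c / 2) z,
          dist (u w.1 w.2) (u w'.1 w'.2) ≤ C * dist w w' ^ α₀) ∧
        (∀ w ∈ parabolicCylinder (c / 2) z, ∀ w' ∈ parabolicCylinder (c / 2) z,
          dist (fderiv ℝ (u w.1) w.2) (fderiv ℝ (u w'.1) w'.2) ≤ C * dist w w' ^ α₁) := by
  obtain ⟨Kf, Cf, αf, hαf, hfact⟩ := NSBoundedHigherRegularityBounds_holds c A P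
  have hr : c / 2 ∈ Ioo 0 c := ⟨by positivity, by linarith⟩
  refine ⟨(Kf 0 (c / 2) : ℝ) + Kf 1 (c / 2) + Kf 2 (c / 2), max (Cf 0 (c / 2) : ℝ) (Cf 1 (c / 2)),
    αf 0 (c / 2), αf 1 (c / 2), hαf 0 _ hr, hαf 1 _ hr, le_max_of_le_left (Cf 0 (c / 2)).coe_nonneg,
    fun u p h z hcl hbd hh hP => ?_⟩
  have hQo : IsOpen (parabolicCylinder c z) := isOpen_parabolicCylinder c z
  -- the distributional solution `(u, p - h)` with its bounds
  have hdist : IsDistributionalNSSolutionOn (parabolicCylinderOpens c z) 1 0 u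
      (fun t x => p t x - h t) :=
    (hcl.isDistributionalNSSolutionOn hQo (Q := parabolicCylinderOpens c z) Subset.rfl).sub_timeFun hh
  have hbd' : ∀ᵐ w ∂(volume.restrict (parabolicCylinder c z)), ‖u w.1 w.2‖ ≤ A := by
    filter_upwards [ae_restrict_mem hQo.measurableSet] with w hw using hbd w hw
  have hP' : ∫⁻ w in parabolicCylinder c z, ‖(fun t x => p t x - h t) w.1 w.2‖ₑ ^ (3 / 2 : ℝ) ≤ P := hP
  obtain ⟨V, hae, -, hH⟩ := hfact u _ z hdist hbd' hP'
  -- `V = u` on the open cylinder (both continuous)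
  have hVc : ContinuousOn (uncurry V) (parabolicCylinder c z) :=
    continuousOn_uncurry_of_holder_exhaustion fun r' hr' =>
      ⟨Cf 0 r', αf 0 r', hαf 0 r' hr', (hH 0 r' hr').1⟩
  have huc : ContinuousOn (uncurry u) (parabolicCylinder c z) := hcl.smooth_velocity.continuousOn
  have hEq : EqOn (uncurry u) (uncurry V) (parabolicCylinder c z) :=
    Measure.eqOn_open_of_ae_eq hae hQo huc hVc
  have hsub : parabolicCylinder (c / 2) z ⊆ parabolicCylinder c z := parabolicCylinder_half_subset c hc z
  -- slices agree near every point of the cylinder, hence so do all spatial derivatives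
  have hslice : ∀ w ∈ parabolicCylinder c z, u w.1 =ᶠ[𝓝 w.2] V w.1 := by
    intro w hw
    rw [mem_parabolicCylinder] at hw
    have hball : ball z.2 c ∈ 𝓝 w.2 := isOpen_ball.mem_nhds (mem_ball.2 hw.2)
    filter_upwards [hball] with y hy
    have hmem : (w.1, y) ∈ parabolicCylinder c z := by
      rw [mem_parabolicCylinder]; exact ⟨hw.1, mem_ball.1 hy⟩
    exact hEq hmem
  have hider : ∀ w ∈ parabolicCylinder c z, ∀ n : ℕ,
      iteratedFDeriv ℝ n (u w.1) w.2 = iteratedFDeriv ℝ n (V w.1) w.2 := fun w hw n =>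
    ((hslice w hw).iteratedFDeriv (𝕜 := ℝ) n).eq_of_nhds
  refine ⟨fun w hw n hn => ?_, fun w hw w' hw' => ?_, fun w hw w' hw' => ?_⟩
  · -- sup bounds of orders `≤ 2`
    rw [hider w (hsub hw) n]
    have hb := (hH n _ hr).2 w hw
    have h0 := (Kf 0 (c / 2)).coe_nonneg
    have h1 := (Kf 1 (c / 2)).coe_nonneg
    have h2 := (Kf 2 (c / 2)).coe_nonneg
    interval_cases n <;> linarith
  · -- joint Hölder continuity of the values
    have hHo := dist_le_of_holderOnWith (hH 0 _ hr).1 hw hw'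
    rw [← hider w (hsub hw) 0, ← hider w' (hsub hw') 0, dist_iteratedFDeriv_zero₂] at hHo
    refine hHo.trans ?_
    gcongr
    exact le_max_left _ _
  · -- joint Hölder continuity of the gradients
    have hHo := dist_le_of_holderOnWith (hH 1 _ hr).1 hw hw'
    rw [← hider w (hsub hw) 1, ← hider w' (hsub hw') 1, dist_eq_norm] at hHo
    rw [dist_eq_norm]
    refine ((norm_fderiv_sub_le_norm_iteratedFDeriv_one_sub _ _ _ _).trans hHo).trans ?_
    gcongr
    exact le_max_right _ _


/-! ## The zoom sequence: off-apex top cylinders -/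

/-- The top cylinder `Q((0,y₀), c)` lies in the origin-based cylinder `Q(R, 0)` as soon as
`‖y₀‖ + c ≤ R`. -/
theorem parabolicCylinder_top_subset {y₀ : (EuclideanSpace ℝ (Fin 3))} {c R : ℝ} (hc : 0 < c) (hR : ‖y₀‖ + c ≤ R) :
    parabolicCylinder c (((0 : ℝ), y₀) : ℝ × (EuclideanSpace ℝ (Fin 3))) ⊆ parabolicCylinder R (0 : ℝ × (EuclideanSpace ℝ (Fin 3))) := by
  intro w hw
  rw [mem_parabolicCylinder] at hw ⊢
  obtain ⟨⟨h1, h2⟩, h3⟩ := hw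
  have hcR : c ≤ R := by linarith [norm_nonneg y₀]
  have hc2 : c ^ 2 ≤ R ^ 2 := by nlinarith
  refine ⟨⟨?_, by simpa using h2⟩, ?_⟩
  · simp only [Prod.fst_zero]
    simp only at h1
    linarith
  · simp only [Prod.snd_zero, dist_zero_right]
    have : ‖w.2‖ ≤ dist w.2 y₀ + ‖y₀‖ := by
      rw [dist_eq_norm]; exact norm_le_norm_sub_add w.2 y₀
    simp only at h3
    linarith

/-- **The ball mean of a continuous pressure is a locally integrable gauge.**  If `p` is continuous on an
open set `O ⊇ (−c², 0) × B̄(y₀, c)`, then `(t, x) ↦ ⨍_{B(y₀,c)} p(t, ·)` is locally integrable on the top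
cylinder `Q((0,y₀), c)` (it is continuous in `t` on `(−c², 0)` by dominated convergence on compact time
intervals). -/
theorem locallyIntegrableOn_ballMean {p : ℝ → (EuclideanSpace ℝ (Fin 3)) → ℝ} {O : Set (ℝ × (EuclideanSpace ℝ (Fin 3)))} (hO : IsOpen O)
    (hp : ContinuousOn (uncurry p) O) {y₀ : (EuclideanSpace ℝ (Fin 3))} {c : ℝ}
    (hsub : Ioo (-c ^ 2) 0 ×ˢ closedBall y₀ c ⊆ O) :
    LocallyIntegrableOn (fun w : ℝ × (EuclideanSpace ℝ (Fin 3)) => ⨍ y in ball y₀ c, p w.1 y)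
      (parabolicCylinder c (((0 : ℝ), y₀) : ℝ × (EuclideanSpace ℝ (Fin 3)))) volume := by
  -- continuity of `t ↦ ∫_{B(y₀,c)} p(t,y) dy` on `(−c², 0)`
  have hcont : ContinuousOn (fun t : ℝ => ∫ y in ball y₀ c, p t y) (Ioo (-c ^ 2) 0) := by
    intro t₀ ht₀
    -- a compact time interval around `t₀`
    obtain ⟨a, b, hat, htb, hab⟩ : ∃ a b : ℝ, a < t₀ ∧ t₀ < b ∧ Icc a b ⊆ Ioo (-c ^ 2) 0 :=
      ⟨(t₀ + -c ^ 2) / 2, t₀ / 2, by linarith [ht₀.1], by linarith [ht₀.2],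
        fun t ht => ⟨by linarith [ht.1, ht₀.1], by linarith [ht.2, ht₀.2]⟩⟩
    have hK : IsCompact (Icc a b ×ˢ closedBall y₀ c) := isCompact_Icc.prod (isCompact_closedBall _ _)
    have hKO : Icc a b ×ˢ closedBall y₀ c ⊆ O := (prod_mono hab Subset.rfl).trans hsub
    obtain ⟨B, hB⟩ := hK.exists_bound_of_continuousOn (hp.mono hKO)
    have hdom : ∀ᶠ t in 𝓝 t₀, ∀ᵐ y ∂(volume.restrict (ball y₀ c)), ‖p t y‖ ≤ B := by
      filter_upwards [Icc_mem_nhds hat htb] with t ht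
      filter_upwards [ae_restrict_mem measurableSet_ball] with y hy
      exact hB (t, y) ⟨ht, ball_subset_closedBall hy⟩
    have hmeas : ∀ᶠ t in 𝓝 t₀, AEStronglyMeasurable (p t) (volume.restrict (ball y₀ c)) := by
      filter_upwards [Icc_mem_nhds hat htb] with t ht
      have hct : ContinuousOn (p t) (ball y₀ c) := by
        refine (hp.comp (Continuous.prodMk_right t).continuousOn fun y hy => ?_).congr fun _ _ => rfl
        exact hKO ⟨ht, ball_subset_closedBall hy⟩
      exact hct.aestronglyMeasurable measurableSet_ball
    have hpt : ∀ᵐ y ∂(volume.restrict (ball y₀ c)), ContinuousAt (fun t => p t y) t₀ := by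
      filter_upwards [ae_restrict_mem measurableSet_ball] with y hy
      have hz : (t₀, y) ∈ O := hKO ⟨⟨hat.le, htb.le⟩, ball_subset_closedBall hy⟩
      have h1 : ContinuousAt (uncurry p) (t₀, y) := hp.continuousAt (hO.mem_nhds hz)
      exact h1.comp (f := fun t : ℝ => (t, y)) (by fun_prop : Continuous fun t : ℝ => (t, y)).continuousAt
    haveI : IsFiniteMeasure (volume.restrict (ball y₀ c)) := ⟨by
      rw [Measure.restrict_apply_univ]; exact measure_ball_lt_top⟩
    exact (continuousAt_of_dominated hmeas hdom (integrable_const B) hpt).continuousWithinAt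
  have hcont' : ContinuousOn (fun w : ℝ × (EuclideanSpace ℝ (Fin 3)) => ⨍ y in ball y₀ c, p w.1 y)
      (parabolicCylinder c (((0 : ℝ), y₀) : ℝ × (EuclideanSpace ℝ (Fin 3)))) := by
    have e : (fun w : ℝ × (EuclideanSpace ℝ (Fin 3)) => ⨍ y in ball y₀ c, p w.1 y) =
        fun w => ((volume : Measure (EuclideanSpace ℝ (Fin 3))).real (ball y₀ c))⁻¹ • ∫ y in ball y₀ c, p w.1 y := by
      funext w; rw [setAverage_eq]
    rw [e]
    have h1 : ContinuousOn (fun w : ℝ × (EuclideanSpace ℝ (Fin 3)) => ∫ y in ball y₀ c, p w.1 y)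
        (parabolicCylinder c (((0 : ℝ), y₀) : ℝ × (EuclideanSpace ℝ (Fin 3)))) := by
      refine hcont.comp (f := fun w : ℝ × (EuclideanSpace ℝ (Fin 3)) => w.1) continuous_fst.continuousOn fun w hw => ?_
      rw [mem_parabolicCylinder] at hw
      simpa using hw.1
    exact h1.const_smul (((volume : Measure (EuclideanSpace ℝ (Fin 3))).real (ball y₀ c))⁻¹)
  exact hcont'.locallyIntegrableOn (isOpen_parabolicCylinder _ _).measurableSet

/-- **Uniform off-apex regularity of the zoom sequence up to the top time.**  Let `w k` be classical
solutions (`ν = 1`, no force) on the cylinders `Q(R_k, 0)`, `R_k → ∞`, obeying the one-point bound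
`‖w k (s, y)‖ ≤ C_u / (√(−s) + ‖y‖)` there and `𝐈(Q(R_k,0)) ≤ I` (Albritton–Barker quantity with the
classical gradient).  Then at every `y₀ ≠ 0` there are `K`, `C ≥ 0`, `α₀, α₁ > 0` such that for all large
`k`, on the top cylinder `Q((0,y₀), ‖y₀‖/8)`: `‖D_xⁿ (w k)‖ ≤ K` for `n ≤ 2`, and `w k`, `D_x (w k)` are
jointly Hölder with constants `(C, α₀)`, `(C, α₁)` — uniformly in `k`. -/
theorem exists_zoom_regularity {Cu : ℝ} {w : ℕ → ℝ → (EuclideanSpace ℝ (Fin 3)) → (EuclideanSpace ℝ (Fin 3))} {π : ℕ → ℝ → (EuclideanSpace ℝ (Fin 3)) → ℝ} {Rk : ℕ → ℝ}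
    {I : ℝ≥0} (hCu : 0 ≤ Cu) (hRk : Tendsto Rk atTop atTop)
    (hcl : ∀ k, IsClassicalNSSolutionOnRegion (parabolicCylinder (Rk k) (0 : ℝ × (EuclideanSpace ℝ (Fin 3)))) 1 0 (w k) (π k))
    (hone : ∀ k, ∀ z ∈ parabolicCylinder (Rk k) (0 : ℝ × (EuclideanSpace ℝ (Fin 3))),
      ‖w k z.1 z.2‖ ≤ Cu / (Real.sqrt (-z.1) + ‖z.2‖))
    (hIk : ∀ k, typeIBound (parabolicCylinder (Rk k) (0 : ℝ × (EuclideanSpace ℝ (Fin 3)))) (w k) (π k)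
      (fun t x => fderiv ℝ (w k t) x) ≤ I)
    {y₀ : (EuclideanSpace ℝ (Fin 3))} (hy₀ : y₀ ≠ 0) :
    ∃ K C α₀ α₁ : ℝ, 0 < α₀ ∧ 0 < α₁ ∧ 0 ≤ C ∧ ∀ᶠ k in atTop,
      (∀ z ∈ parabolicCylinder (‖y₀‖ / 8) (((0 : ℝ), y₀) : ℝ × (EuclideanSpace ℝ (Fin 3))), ∀ n ≤ 2,
        ‖iteratedFDeriv ℝ n (w k z.1) z.2‖ ≤ K) ∧
      (∀ z ∈ parabolicCylinder (‖y₀‖ / 8) (((0 : ℝ), y₀) : ℝ × (EuclideanSpace ℝ (Fin 3))),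
        ∀ z' ∈ parabolicCylinder (‖y₀‖ / 8) (((0 : ℝ), y₀) : ℝ × (EuclideanSpace ℝ (Fin 3))),
          dist (w k z.1 z.2) (w k z'.1 z'.2) ≤ C * dist z z' ^ α₀) ∧
      (∀ z ∈ parabolicCylinder (‖y₀‖ / 8) (((0 : ℝ), y₀) : ℝ × (EuclideanSpace ℝ (Fin 3))),
        ∀ z' ∈ parabolicCylinder (‖y₀‖ / 8) (((0 : ℝ), y₀) : ℝ × (EuclideanSpace ℝ (Fin 3))),
          dist (fderiv ℝ (w k z.1) z.2) (fderiv ℝ (w k z'.1) z'.2) ≤ C * dist z z' ^ α₁) := by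
  have hy : 0 < ‖y₀‖ := norm_pos_iff.2 hy₀
  set c : ℝ := ‖y₀‖ / 4 with hc_def
  have hc : 0 < c := by positivity
  have hc8 : c / 2 = ‖y₀‖ / 8 := by rw [hc_def]; ring
  obtain ⟨K, C, α₀, α₁, hα₀, hα₁, hC, hreg⟩ :=
    exists_cylinder_regularity c (Cu / (3 * c)) ((c ^ 2).toNNReal * I) hc
  refine ⟨K, C, α₀, α₁, hα₀, hα₁, hC, ?_⟩
  filter_upwards [tendsto_atTop.1 hRk (‖y₀‖ + c + 1)] with k hk
  have hRk' : ‖y₀‖ + c ≤ Rk k := by linarith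
  have hsubk : parabolicCylinder c (((0 : ℝ), y₀) : ℝ × (EuclideanSpace ℝ (Fin 3))) ⊆ parabolicCylinder (Rk k) (0 : ℝ × (EuclideanSpace ℝ (Fin 3))) :=
    parabolicCylinder_top_subset hc hRk'
  -- the zoom restricted to the top cylinder
  have hclk : IsClassicalNSSolutionOnRegion (parabolicCylinder c (((0 : ℝ), y₀) : ℝ × (EuclideanSpace ℝ (Fin 3)))) 1 0 (w k) (π k) :=
    (hcl k).mono_of_isOpen hsubk (isOpen_parabolicCylinder _ _)
  -- the velocity bound off the apex
  have hbd : ∀ z ∈ parabolicCylinder c (((0 : ℝ), y₀) : ℝ × (EuclideanSpace ℝ (Fin 3))), ‖w k z.1 z.2‖ ≤ Cu / (3 * c) := by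
    intro z hz
    have h1 := hone k z (hsubk hz)
    rw [mem_parabolicCylinder] at hz
    have hz2 : 3 * c ≤ ‖z.2‖ := by
      have h3 : dist z.2 y₀ < c := by simpa using hz.2
      have : ‖y₀‖ ≤ ‖z.2‖ + dist z.2 y₀ := by
        rw [dist_eq_norm, norm_sub_rev]; exact norm_le_norm_add_norm_sub' y₀ z.2 |>.trans_eq (by ring)
      rw [hc_def]; linarith
    have hden : 3 * c ≤ Real.sqrt (-z.1) + ‖z.2‖ := by linarith [Real.sqrt_nonneg (-z.1)]
    exact h1.trans (div_le_div_of_nonneg_left hCu (by positivity) hden)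
  -- the ball-mean gauge of the pressure is locally integrable
  have hloc : LocallyIntegrableOn (fun z : ℝ × (EuclideanSpace ℝ (Fin 3)) => ⨍ y in ball y₀ c, π k z.1 y)
      (parabolicCylinder c (((0 : ℝ), y₀) : ℝ × (EuclideanSpace ℝ (Fin 3)))) volume := by
    refine locallyIntegrableOn_ballMean (isOpen_parabolicCylinder _ _) (hcl k).smooth_pressure.continuousOn
      fun z hz => ?_
    obtain ⟨hz1, hz2⟩ := hz
    rw [mem_parabolicCylinder]
    have hcR : c ≤ Rk k := by linarith [norm_nonneg y₀]
    refine ⟨⟨?_, by simpa using hz1.2⟩, ?_⟩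
    · simp only [Prod.fst_zero]
      nlinarith [hz1.1]
    · simp only [Prod.snd_zero, dist_zero_right]
      have h3 : ‖z.2 - y₀‖ ≤ c := by simpa [dist_eq_norm] using (mem_closedBall.1 hz2)
      have : ‖z.2‖ ≤ ‖z.2 - y₀‖ + ‖y₀‖ := norm_le_norm_sub_add z.2 y₀
      linarith
  -- the pressure mass of the gauged pressure from `𝐈 ≤ I`
  have hP : ∫⁻ z in parabolicCylinder c (((0 : ℝ), y₀) : ℝ × (EuclideanSpace ℝ (Fin 3))),
      ‖π k z.1 z.2 - ⨍ y in ball y₀ c, π k z.1 y‖ₑ ^ (3 / 2 : ℝ) ≤ (((c ^ 2).toNNReal * I : ℝ≥0) : ℝ≥0∞) := by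
    have hD := cknD_sub_ballMean_le_of_typeIBound_le (hIk k) hc hsubk
    rw [cknD] at hD
    have h0 : ENNReal.ofReal c ^ 2 ≠ 0 := pow_ne_zero _ (ENNReal.ofReal_pos.2 hc).ne'
    have htop : ENNReal.ofReal c ^ 2 ≠ ⊤ := ENNReal.pow_ne_top ENNReal.ofReal_ne_top
    have ec : ENNReal.ofReal c ^ 2 = (((c ^ 2).toNNReal : ℝ≥0) : ℝ≥0∞) := by
      rw [← ENNReal.ofReal_pow hc.le]; rfl
    calc ∫⁻ z in parabolicCylinder c (((0 : ℝ), y₀) : ℝ × (EuclideanSpace ℝ (Fin 3))),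
          ‖π k z.1 z.2 - ⨍ y in ball y₀ c, π k z.1 y‖ₑ ^ (3 / 2 : ℝ)
        = ENNReal.ofReal c ^ 2 * ((ENNReal.ofReal c ^ 2)⁻¹ *
            ∫⁻ z in parabolicCylinder c (((0 : ℝ), y₀) : ℝ × (EuclideanSpace ℝ (Fin 3))),
              ‖π k z.1 z.2 - ⨍ y in ball y₀ c, π k z.1 y‖ₑ ^ (3 / 2 : ℝ)) := by
          rw [← mul_assoc, ENNReal.mul_inv_cancel h0 htop, one_mul]
      _ ≤ ENNReal.ofReal c ^ 2 * I := by gcongr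
      _ = (((c ^ 2).toNNReal * I : ℝ≥0) : ℝ≥0∞) := by rw [ENNReal.coe_mul, ec]
  have key := hreg (w k) (π k) (fun t => ⨍ y in ball y₀ c, π k t y) ((0 : ℝ), y₀) hclk hbd hloc hP
  rw [hc8] at key
  exact key

end Summit.NavierStokesRegularity.NavierStokesRegularity.Theorems.QuietScarPocketDoor

end
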